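import Summits.HodgeConjecture.HodgeConjecture.Theorems.F0P2pJacquetConstituentLemmas       -- ★ p828054 (file 1/4)
import Summits.HodgeConjecture.HodgeConjecture.Theorems.F0P2pTorusPairsAndVacuity           -- ★ file 4a: `subsingleton_smoothInd_of_not_continuous`
import Summits.HodgeConjecture.HodgeConjecture.Theorems.F0P2nBorelCharactersUnipotent        -- ★ `deltaChar_cmBorel_eq_one`
import Summits.HodgeConjecture.HodgeConjecture.Theorems.F0P3bLocalNonsplitCompactCenter      -- ★ `isCompact_center_local_of_forall_eq_scalar`
import Summits.HodgeConjecture.HodgeConjecture.Theorems.F0P3XiUnramNonsplitInstance           -- ★ `isAdmissible_cmPrincipalSeries`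
import Summits.HodgeConjecture.HodgeConjecture.Theorems.F0P3XiPacketFamilyOfRecord            -- ★ `isAdmissible_of_isConstituentOf`
import Literature.NumberTheory.Rogawski1990.U3SupercuspidalJacquetCriterion                   -- ★ letter N6 (hypothesis only)
import Literature.NumberTheory.Rogawski1990.CMLocalAPacketMembers                             -- ★ `Gqs`, `qsForm`
import Literature.NumberTheory.Automorphic.LocalUnitaryGroupCenter                             -- ★ `forall_mem_center_cmLocal_eq_scalar`
import HarnessLib

/-!
# Crux `H413`, pay-down of the K1w letter — file 4b: the interface of the abstract Weyl theorem at `I = cmPrincipalSeries L 3 v χ`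

Cell hodgecm-mathlib (D-0151), FLOOR 0, crux item H413 = stmt-HodgeConjecture-24833; K1 sub-line `Lines/F0_P2GR91NJacquetK1.lean`, letter ★
`Rogawski1990.cmPrincipalSeries_isConstituentOf_weylConj`.  The abstract rank-one theorem ★ `F0P2pWeylConstituentsRankOne.isConstituentOf_of_weylData`
is instantiated SYNTACTICALLY at the tree's spelling `I := cmPrincipalSeries L 3 v χ` of the principal series of `U(Φ₃)(L⁺_v)` (so that the letter N1
★ `U3PrincipalSeriesJacquetFiltration` is consumed verbatim — matching it against the `normalizedInd` spelling costs > 3·10⁶ heartbeats per clause);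
this file reads each interface hypothesis on that spelling from the ★ generic lemmas of file 1/4, one small statement at a time (theorems only):
`isSmooth_cmPrincipalSeries`; Frobenius existence ∕ uniqueness `exists_intertwiningMap_cmPrincipalSeries_ne_zero`, `intertwiningMap_cmPrincipalSeries_eq_smul`;
evaluation at one `exists_mem_mk_ne_zero_of_ne_bot`; **`not_subsingleton_coinvariants_of_isConstituentOf_cmPrincipalSeries`** — at a NON-SPLIT `v`, no
constituent of `i_G(χ)` has zero Jacquet module, from the booked letter N6 ★ `Rogawski1990.u3_isSupercuspidal_iff_jacquet_eq_zero` (`⇐` only), ★ projectivity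
(file 1/4 §3–§4), the compact centre ★ `isCompact_center_local_of_forall_eq_scalar` and the compact open ★ `localIntegralLevel` (read on the matrix carrier
`↥(unitaryGroupOfForm …)` so that type-class synthesis sees ONE topology), admissibility ★ `isAdmissible_cmPrincipalSeries` ∕ ★ `isAdmissible_of_isConstituentOf`;
and `subsingleton_cmPrincipalSeries_of_not_continuous` (file 4a §2 on the CM carrier).
HC_CM is proved only modulo the 2 remaining named inputs (hLiu418, h413) until rung 0 closes; nothing here proves HC_CM.

## References
* [Rogawski1990] §12.2 pp. 173–174.  * [Casselman1995] Thm. 3.2.4, Thm. 5.3.1, Thm. 6.3.5.  * [BernsteinZelevinsky1977] Prop. 1.9.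
-/

set_option autoImplicit false
-- the mandated namespace has the single-problem summit's repeated segment (`HodgeConjecture.HodgeConjecture`)
set_option linter.dupNamespace false

noncomputable section

open NumberField IsDedekindDomain MeasureTheory
open scoped Matrix

open Literature.NumberTheory Literature.NumberTheory.Automorphic Literature.NumberTheory.Automorphic.UnitaryGroup
open Literature.NumberTheory.Rogawski1990
open Literature.RepresentationTheory.FiniteGroups Literature.RepresentationTheory.Semisimple

namespace Summit.HodgeConjecture.HodgeConjecture.Cruxes.H413.F0P2pCmPrincipalSeriesInterface

open F0P2pTorusPairsAndVacuity

section CM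

variable (L : Type) [Field L] [NumberField L] [IsCMField L] (v : HeightOneSpectrum (𝓞 ↥(maximalRealSubfield L)))

/-! ## The interface at `I = cmPrincipalSeries L 3 v χ` (each item: one ★ generic lemma read on the CM spelling) -/

set_option synthInstance.maxHeartbeats 400000 in
set_option maxHeartbeats 8000000 in
/-- `i_G(χ) = cmPrincipalSeries L 3 v χ` is smooth (it IS ★ `smoothIndRep`). [cite: Rogawski1990, §12.2 p. 173] -/
theorem isSmooth_cmPrincipalSeries (χ : ↥(torusU (conjLocal L (IsCMField.complexConj L) v) (cmLocalForm L 3 v)) →* ℂˣ) :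
    (cmPrincipalSeries L 3 v χ).IsSmooth :=
  haveI := locallyCompactSpace_cmBorelU L 3 v
  Representation.isSmooth_smoothInd (cmBorelTriple L 3 v).P _

set_option synthInstance.maxHeartbeats 400000 in
set_option maxHeartbeats 8000000 in
/-- Frobenius, existence form, into `cmPrincipalSeries L 3 v χ` (★ file 1 §5; `δ_B|_N = 1` ★). [cite: BernsteinZelevinsky1977, Prop. 1.9 (b)] -/
theorem exists_intertwiningMap_cmPrincipalSeries_ne_zero
    (χ : ↥(torusU (conjLocal L (IsCMField.complexConj L) v) (cmLocalForm L 3 v)) →* ℂˣ)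
    {W : Type*} [AddCommGroup W] [Module ℂ W]
    (π : Representation ℂ ↥(unitaryGroupOfForm (conjLocal L (IsCMField.complexConj L) v) (cmLocalForm L 3 v)) W) (hπ : π.IsSmooth)
    (φ : haveI := locallyCompactSpace_cmBorelU L 3 v
      (π.normalizedJacquet (cmBorelTriple L 3 v)).IntertwiningMap ((Representation.trivial ℂ ↥(cmBorelTriple L 3 v).M ℂ).twist χ))
    (hφ : φ ≠ 0) : ∃ B : π.IntertwiningMap (cmPrincipalSeries L 3 v χ), B ≠ 0 :=
  haveI := locallyCompactSpace_cmBorelU L 3 v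
  F0P2pJacquetConstituentLemmas.exists_intertwiningMap_normalizedInd_ne_zero (cmBorelTriple L 3 v)
    (F0P2nBorelCharactersUnipotent.deltaChar_cmBorel_eq_one L v) π hπ χ φ hφ

set_option synthInstance.maxHeartbeats 400000 in
set_option maxHeartbeats 8000000 in
/-- Frobenius, uniqueness form, into `cmPrincipalSeries L 3 v χ` (★ file 1 §5). [cite: BernsteinZelevinsky1977, Prop. 1.9 (b)] -/
theorem intertwiningMap_cmPrincipalSeries_eq_smul
    (χ : ↥(torusU (conjLocal L (IsCMField.complexConj L) v) (cmLocalForm L 3 v)) →* ℂˣ)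
    {W : Type*} [AddCommGroup W] [Module ℂ W]
    (π : Representation ℂ ↥(unitaryGroupOfForm (conjLocal L (IsCMField.complexConj L) v) (cmLocalForm L 3 v)) W) (hπ : π.IsSmooth)
    (huniq : haveI := locallyCompactSpace_cmBorelU L 3 v
      ∀ ψ₁ ψ₂ : (π.normalizedJacquet (cmBorelTriple L 3 v)).IntertwiningMap ((Representation.trivial ℂ ↥(cmBorelTriple L 3 v).M ℂ).twist χ),
        ψ₁ ≠ 0 → ∃ c : ℂ, ψ₂ = c • ψ₁)
    (B₁ B₂ : π.IntertwiningMap (cmPrincipalSeries L 3 v χ)) (h₁ : B₁ ≠ 0) : ∃ c : ℂ, B₂ = c • B₁ :=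
  haveI := locallyCompactSpace_cmBorelU L 3 v
  F0P2pJacquetConstituentLemmas.intertwiningMap_normalizedInd_eq_smul (cmBorelTriple L 3 v)
    (F0P2nBorelCharactersUnipotent.deltaChar_cmBorel_eq_one L v) π hπ χ huniq B₁ B₂ h₁

set_option synthInstance.maxHeartbeats 400000 in
set_option maxHeartbeats 8000000 in
/-- Evaluation at one: the Jacquet image of a non-zero subrepresentation of `cmPrincipalSeries L 3 v χ` is non-zero (★ file 1 §2).
[cite: BernsteinZelevinsky1977, Prop. 1.9 (c)] -/
theorem exists_mem_mk_ne_zero_of_ne_bot (χ : ↥(torusU (conjLocal L (IsCMField.complexConj L) v) (cmLocalForm L 3 v)) →* ℂˣ)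
    (F : Subrepresentation (cmPrincipalSeries L 3 v χ)) (hF : F ≠ ⊥) :
    ∃ f ∈ F, Representation.Coinvariants.mk ((cmBorelTriple L 3 v).restrict (cmPrincipalSeries L 3 v χ)) f ≠ 0 := by
  haveI := locallyCompactSpace_cmBorelU L 3 v
  obtain ⟨ev, hev, -⟩ := F0P2pJacquetConstituentLemmas.exists_evalOne_coinvariants (cmBorelTriple L 3 v) χ
    (F0P2nBorelCharactersUnipotent.deltaChar_cmBorel_eq_one L v)
  obtain ⟨f, hf, hf1⟩ := F0P2pJacquetConstituentLemmas.exists_mem_toFun_one_ne_zero_of_ne_bot (cmBorelTriple L 3 v) χ F hF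
  refine ⟨f, hf, fun h0 => hf1 ?_⟩
  have h0' : Representation.Coinvariants.mk ((cmBorelTriple L 3 v).restrict (Representation.normalizedInd (cmBorelTriple L 3 v)
      ((Representation.trivial ℂ ↥(cmBorelTriple L 3 v).M ℂ).twist χ))) f = 0 := h0
  rw [← hev f, h0', map_zero]

set_option synthInstance.maxHeartbeats 400000 in
set_option maxHeartbeats 8000000 in
/-- **No constituent of `i_G(χ)` (`G = U(Φ₃)(L⁺_v)`, `v` NON-SPLIT) has zero Jacquet module** — from the letter N6 (`⇐`: zero Jacquet module ⇒
supercuspidal), ★ projectivity (compact centre ★ `isCompact_center_local_of_forall_eq_scalar` + the compact open ★ `localIntegralLevel` at non-split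
`v`), admissibility of constituents of the admissible `i_G(χ)` (★), and file 1 §4. [cite: Casselman1995, Thm. 6.3.5] [cite: Rogawski1990, §12.2 p. 173] -/
theorem not_subsingleton_coinvariants_of_isConstituentOf_cmPrincipalSeries (hN6 : u3_isSupercuspidal_iff_jacquet_eq_zero)
    (hns : ∀ w : PlacesOver L v, IsCMField.complexConj L • w.1 = w.1)
    (χ : ↥(torusU (conjLocal L (IsCMField.complexConj L) v) (cmLocalForm L 3 v)) →* ℂˣ)
    (r : SmoothIrrep ↥(unitaryGroupOfForm (conjLocal L (IsCMField.complexConj L) v) (cmLocalForm L 3 v)))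
    (hr : (IrrClass.mk r).IsConstituentOf (cmPrincipalSeries L 3 v χ))
    (h0 : Subsingleton ((cmBorelTriple L 3 v).restrict r.ρ).Coinvariants) : False := by
  haveI := locallyCompactSpace_cmBorelU L 3 v
  -- frame facts at the non-split place, read on the matrix carrier `↥(unitaryGroupOfForm …)`
  have hK : ∃ K₀ : Subgroup ↥(unitaryGroupOfForm (conjLocal L (IsCMField.complexConj L) v) (cmLocalForm L 3 v)),
      IsOpen (K₀ : Set ↥(unitaryGroupOfForm (conjLocal L (IsCMField.complexConj L) v) (cmLocalForm L 3 v))) ∧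
      IsCompact (K₀ : Set ↥(unitaryGroupOfForm (conjLocal L (IsCMField.complexConj L) v) (cmLocalForm L 3 v))) :=
    ⟨localIntegralLevel (IsCMField.complexConj L) 3 (qsForm L) v, isOpen_localIntegralLevel (IsCMField.complexConj L) 3 (qsForm L) v,
      isCompact_localIntegralLevel (IsCMField.complexConj L) 3 (qsForm L) v⟩
  obtain ⟨K₀, hK₀o, hK₀c⟩ := hK
  have hZ : IsCompact ((Subgroup.center ↥(unitaryGroupOfForm (conjLocal L (IsCMField.complexConj L) v) (cmLocalForm L 3 v))) :
      Set ↥(unitaryGroupOfForm (conjLocal L (IsCMField.complexConj L) v) (cmLocalForm L 3 v))) :=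
    F0P3bLocalNonsplitCompactCenter.isCompact_center_local_of_forall_eq_scalar (IsCMField.complexConj L) (qsForm L) v
      (IsCMField.complexConj_ne_one L) (isUnit_antidiagOne_det L 3) hns
      (forall_mem_center_cmLocal_eq_scalar L (qsForm L) (antidiagOne_isHermitian L 3) (isUnit_antidiagOne_det L 3) v hns)
  have hadm : r.ρ.IsAdmissible := (IrrClass.isAdmissible_mk r).1
    (F0P3XiPacketFamilyOfRecord.isAdmissible_of_isConstituentOf hr (F0P3XiUnramNonsplitInstance.isAdmissible_cmPrincipalSeries L v χ))
  have hsc : r.ρ.IsSupercuspidal := (IrrClass.isSupercuspidal_mk r).1 ((hN6 L v hns r).2 h0)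
  exact F0P2pJacquetConstituentLemmas.not_isConstituentOf_normalizedInd_of_subsingleton_coinvariants (cmBorelTriple L 3 v)
    hK₀o hK₀c hZ χ (F0P2nBorelCharactersUnipotent.deltaChar_cmBorel_eq_one L v) r hsc hadm h0 hr

set_option synthInstance.maxHeartbeats 400000 in
set_option maxHeartbeats 8000000 in
/-- `i_G(χ) = 0` for a DIScontinuous torus character `χ` of `U(Φ₃)(L⁺_v)` (§2 read on the CM carrier). [cite: BernsteinZelevinsky1976, §2.21–2.23] -/
theorem subsingleton_cmPrincipalSeries_of_not_continuous
    (χ : ↥(torusU (conjLocal L (IsCMField.complexConj L) v) (cmLocalForm L 3 v)) →* ℂˣ)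
    (hχ : ¬ Continuous fun t : ↥(torusU (conjLocal L (IsCMField.complexConj L) v) (cmLocalForm L 3 v)) => ((χ t : ℂˣ) : ℂ)) :
    haveI := locallyCompactSpace_cmBorelU L 3 v
    Subsingleton (Representation.SmoothInd (cmBorelTriple L 3 v).P
      (Representation.twist (((Representation.trivial ℂ ↥(torusU (conjLocal L (IsCMField.complexConj L) v) (cmLocalForm L 3 v)) ℂ).twist
        χ).comp (cmBorelTriple L 3 v).proj) (rootDeltaChar (cmBorelTriple L 3 v).P))) :=
  haveI := locallyCompactSpace_cmBorelU L 3 v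
  subsingleton_smoothInd_of_not_continuous (cmBorelTriple L 3 v) χ hχ

end CM

end Summit.HodgeConjecture.HodgeConjecture.Cruxes.H413.F0P2pCmPrincipalSeriesInterface

end
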